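import Summits.ResolutionOfSingularities.ResolutionOfSingularities.Theorems.FrobeniusLadderFInjectiveMacaulayficationTauFloorF5XChartAlgebra
import Summits.ResolutionOfSingularities.ResolutionOfSingularities.Theorems.FrobeniusLadderFInjectiveMacaulayficationTauFloorF5YChartIdent
import Summits.ResolutionOfSingularities.ResolutionOfSingularities.Theorems.FrobeniusLadderFInjectiveMacaulayficationReesChartFacts
import HarnessLib

/-!
# (N1-X) The tower `T₄ = k[x,W₀,W₁,W₂][y][u][t][W₄]` IS the Rees chart `D(x̄)` of `Bl_τ(P2d4F5)`: `T₄ ≃+* A₀[τ/x̄]`, and `A₀[τ/x̄]` is CM at every prime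
# (crux `FInjectiveMacaulayfication` stmt-ResolutionOfSingularities-15315, chain w45a; res-L1-w45a-plan-1 R18.32 «(N1) ROW #2 TWO-SIDED → stub-3»;
# seat res-L1-w45a-stub-3 g10; twin of `TauFloorF5YChartIdent` + `TauFloorF5YChartFacts` §1)

[OURS · L1 W4.5a] Support file (`--supports stmt-ResolutionOfSingularities-15315 --as helper`); replaces the role of NO printed item; NOT a statement of
any manuscript; def-free; UNCONDITIONalgebraMap (MvPolynomial (Fin 5) k ⧸ Ideal.span {f}) (Localization.Away (Ideal.Quotient.mk (Ideal.span {f}) (X 0) : MvPolynomial (Fin 5) k ⧸ Ideal.span {f})); characteristic-free. AI-written (AI review is weaker than expert review).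

* §1 ★ `chartMap_injective` — `φ : T₄ → A₀[1/x̄]` is injective (`x` is a non-zero-divisor of the FLAT `k[x,W₀,W₁,W₂]`-algebra `T₄`, p629082 §4; the blow-down map
  extended to `A₀[1/x̄] → T₄[1/x]` inverts `φ` after `T₄ → T₄[1/x]`).
* §2 ★★ `exists_chartEquiv` — `∃ e : T₄ ≃+* blowupAlgebra τ x̄` with `x,W₀,W₁,W₂,y,u,t,W₄ ↦ x̄, ȳ²/x̄, ū²/x̄, t̄²/x̄, ȳ, ū, t̄, z̄/x̄`.
* §3 ★★ `cmCl_localization_blowupAlgebra` — the CM clause at EVERY prime of `A₀[τ/x̄]`: one application of `FlatIntegralCM.cmCl_localization_of_isRegularRing`,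
  transported along `e`.
[cite: GortzWedhorn2020, (13.19) p. 415] [cite: StacksProject, Tag 0804] [cite: Matsumura1987, Thm. 17.8, Thm. 23.3 (context)]
-/

-- single-problem summit: the doubled namespace component is forced
set_option linter.dupNamespace false

noncomputable section

namespace Summit.ResolutionOfSingularities.ResolutionOfSingularities.Theorems.FInjectiveMacaulayfication.TauFloorF5XChartIdent

open MvPolynomial IsLocalization Literature.AlgebraicGeometry.Resolution
open Summit.ResolutionOfSingularities.ResolutionOfSingularities.Theorems.FInjectiveMacaulayfication
open SliceableCentre TauFloorF5XChartAlgebra TauFloorF5YChartIdent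

variable (k : Type) [Field k]

/-! ## §1 The chart map is injective -/

set_option synthInstance.maxHeartbeats 200000 in
set_option maxHeartbeats 1600000 in
-- one `IsLocalization` lift + a generator-by-generator comparison of two ring maps out of the tower
/-- ★ **The chart map `φ : T₄ → A₀[1/x̄]` is injective.** [folklore] -/
theorem chartMap_injective (f : MvPolynomial (Fin 5) k) (hf : f = X 4 ^ 2 + X 0 ^ 2 * X 4 + X 1 ^ 5 + X 2 ^ 5 + X 3 ^ 5)
    (g₁ : Polynomial (MvPolynomial (Fin 4) k)) (hg₁ : g₁ = Polynomial.X ^ 2 - Polynomial.C (X 0 * X 1))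
    (g₂ : Polynomial (AdjoinRoot g₁)) (hg₂ : g₂ = Polynomial.X ^ 2 - Polynomial.C (algebraMap (MvPolynomial (Fin 4) k) (AdjoinRoot g₁) (X 0 * X 2)))
    (g₃ : Polynomial (AdjoinRoot g₂)) (hg₃ : g₃ = Polynomial.X ^ 2 - Polynomial.C (algebraMap (MvPolynomial (Fin 4) k) (AdjoinRoot g₂) (X 0 * X 3)))
    (g₄ : Polynomial (AdjoinRoot g₃))
    (hg₄ : g₄ = Polynomial.X ^ 2 + (Polynomial.C (algebraMap (MvPolynomial (Fin 4) k) (AdjoinRoot g₃) (X 0)) * Polynomial.X +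
      Polynomial.C (algebraMap (MvPolynomial (Fin 4) k) (AdjoinRoot g₃) (X 1 ^ 2) * algebraMap (AdjoinRoot g₁) (AdjoinRoot g₃) (AdjoinRoot.root g₁) +
        algebraMap (MvPolynomial (Fin 4) k) (AdjoinRoot g₃) (X 2 ^ 2) * AdjoinRoot.of g₃ (AdjoinRoot.root g₂) +
        algebraMap (MvPolynomial (Fin 4) k) (AdjoinRoot g₃) (X 3 ^ 2) * AdjoinRoot.root g₃)))
    (φ : AdjoinRoot g₄ →+* Localization.Away (Ideal.Quotient.mk (Ideal.span {f}) (X 0) : MvPolynomial (Fin 5) k ⧸ Ideal.span {f}))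
    (hφC : ∀ a : k, φ (algebraMap (MvPolynomial (Fin 4) k) (AdjoinRoot g₄) (C a)) = algebraMap (MvPolynomial (Fin 5) k ⧸ Ideal.span {f}) (Localization.Away (Ideal.Quotient.mk (Ideal.span {f}) (X 0) : MvPolynomial (Fin 5) k ⧸ Ideal.span {f})) (Ideal.Quotient.mk (Ideal.span {f}) (C a)))
    (hφX : ∀ i : Fin 4, φ (algebraMap (MvPolynomial (Fin 4) k) (AdjoinRoot g₄) (X i)) =
      ![algebraMap (MvPolynomial (Fin 5) k ⧸ Ideal.span {f}) (Localization.Away (Ideal.Quotient.mk (Ideal.span {f}) (X 0) : MvPolynomial (Fin 5) k ⧸ Ideal.span {f})) (Ideal.Quotient.mk (Ideal.span {f}) (X 0)),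
        algebraMap (MvPolynomial (Fin 5) k ⧸ Ideal.span {f}) (Localization.Away (Ideal.Quotient.mk (Ideal.span {f}) (X 0) : MvPolynomial (Fin 5) k ⧸ Ideal.span {f})) (Ideal.Quotient.mk (Ideal.span {f}) (X 1)) ^ 2 * Away.invSelf (Ideal.Quotient.mk (Ideal.span {f}) (X 0)),
        algebraMap (MvPolynomial (Fin 5) k ⧸ Ideal.span {f}) (Localization.Away (Ideal.Quotient.mk (Ideal.span {f}) (X 0) : MvPolynomial (Fin 5) k ⧸ Ideal.span {f})) (Ideal.Quotient.mk (Ideal.span {f}) (X 2)) ^ 2 * Away.invSelf (Ideal.Quotient.mk (Ideal.span {f}) (X 0)),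
        algebraMap (MvPolynomial (Fin 5) k ⧸ Ideal.span {f}) (Localization.Away (Ideal.Quotient.mk (Ideal.span {f}) (X 0) : MvPolynomial (Fin 5) k ⧸ Ideal.span {f})) (Ideal.Quotient.mk (Ideal.span {f}) (X 3)) ^ 2 * Away.invSelf (Ideal.Quotient.mk (Ideal.span {f}) (X 0))] i)
    (hφy : φ (algebraMap (AdjoinRoot g₁) (AdjoinRoot g₄) (AdjoinRoot.root g₁)) = algebraMap (MvPolynomial (Fin 5) k ⧸ Ideal.span {f}) (Localization.Away (Ideal.Quotient.mk (Ideal.span {f}) (X 0) : MvPolynomial (Fin 5) k ⧸ Ideal.span {f})) (Ideal.Quotient.mk (Ideal.span {f}) (X 1)))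
    (hφu : φ (algebraMap (AdjoinRoot g₂) (AdjoinRoot g₄) (AdjoinRoot.root g₂)) = algebraMap (MvPolynomial (Fin 5) k ⧸ Ideal.span {f}) (Localization.Away (Ideal.Quotient.mk (Ideal.span {f}) (X 0) : MvPolynomial (Fin 5) k ⧸ Ideal.span {f})) (Ideal.Quotient.mk (Ideal.span {f}) (X 2)))
    (hφt : φ (AdjoinRoot.of g₄ (AdjoinRoot.root g₃)) = algebraMap (MvPolynomial (Fin 5) k ⧸ Ideal.span {f}) (Localization.Away (Ideal.Quotient.mk (Ideal.span {f}) (X 0) : MvPolynomial (Fin 5) k ⧸ Ideal.span {f})) (Ideal.Quotient.mk (Ideal.span {f}) (X 3)))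
    (hφW : φ (AdjoinRoot.root g₄) = algebraMap (MvPolynomial (Fin 5) k ⧸ Ideal.span {f}) (Localization.Away (Ideal.Quotient.mk (Ideal.span {f}) (X 0) : MvPolynomial (Fin 5) k ⧸ Ideal.span {f})) (Ideal.Quotient.mk (Ideal.span {f}) (X 4)) * Away.invSelf (Ideal.Quotient.mk (Ideal.span {f}) (X 0))) :
    Function.Injective φ := by
  classical
  obtain ⟨hfree, -⟩ := free_finite_tower k g₁ hg₁ g₂ hg₂ g₃ hg₃ g₄ hg₄
  let mkA : MvPolynomial (Fin 5) k →+* MvPolynomial (Fin 5) k ⧸ Ideal.span {f} := Ideal.Quotient.mk (Ideal.span {f})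
  let L := Localization.Away (mkA (X 0))
  let ι : (MvPolynomial (Fin 5) k ⧸ Ideal.span {f}) →+* L := algebraMap _ _
  let inv : L := Away.invSelf (mkA (X 0))
  let aM : MvPolynomial (Fin 4) k →+* AdjoinRoot g₄ := algebraMap _ _
  let xT : AdjoinRoot g₄ := aM (X 0)
  -- `x` is a non-zero-divisor of `T₄` (flatness over the domain `B₀`), so `T₄ → T₄[1/x]` is injective
  have hx1 : xT ∈ nonZeroDivisors (AdjoinRoot g₄) := FlatIntegralCM.mem_nonZeroDivisors_algebraMap_of_flat_of_ne_zero (X_ne_zero (0 : Fin 4))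
  let LT := Localization.Away xT
  let ιT : AdjoinRoot g₄ →+* LT := algebraMap _ _
  have hιT_inj : Function.Injective ιT :=
    IsLocalization.injective LT (M := Submonoid.powers xT) ((Submonoid.powers_le (P := nonZeroDivisors _)).mpr hx1)
  -- the blow-down map and its extension `ψ : A₀[1/x̄] → T₄[1/x]`
  obtain ⟨ψ₁, hψX, hψC⟩ := exists_blowdownMap k f hf g₁ hg₁ g₂ hg₂ g₃ hg₃ g₄ hg₄
  have hψx : ψ₁ (mkA (X 0)) = xT := hψX 0
  have hunit : IsUnit ((ιT.comp ψ₁) (mkA (X 0))) := by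
    rw [RingHom.comp_apply, hψx]
    exact IsLocalization.Away.algebraMap_isUnit xT
  let ψ : L →+* LT := IsLocalization.Away.lift (mkA (X 0)) hunit
  have hψι : ∀ a, ψ (ι a) = ιT (ψ₁ a) := fun a => IsLocalization.Away.lift_eq (mkA (X 0)) hunit a
  have hψi : ψ inv * ιT xT = 1 := by
    have h1 : ψ inv * ψ (ι (mkA (X 0))) = 1 := by rw [← map_mul, mul_comm, Away.mul_invSelf, map_one]
    rwa [hψι, hψx] at h1
  have hcan : ∀ c : AdjoinRoot g₄, ιT (xT * c) * ψ inv = ιT c := fun c => by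
    rw [map_mul, mul_comm (ιT xT), mul_assoc, mul_comm (ιT xT), hψi, mul_one]
  -- the relations of the tower for the `W₀, W₁, W₂` generators
  have R1 : (algebraMap (AdjoinRoot g₁) (AdjoinRoot g₄) (AdjoinRoot.root g₁)) ^ 2 = xT * aM (X 1) := by
    have h := congrArg (algebraMap (AdjoinRoot g₁) (AdjoinRoot g₄)) (root_sq_of_eq _ g₁ hg₁)
    rw [map_pow, ← AdjoinRoot.algebraMap_eq, ← IsScalarTower.algebraMap_apply, map_mul] at h
    exact h
  have R2 : (algebraMap (AdjoinRoot g₂) (AdjoinRoot g₄) (AdjoinRoot.root g₂)) ^ 2 = xT * aM (X 2) := by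
    have h := congrArg (algebraMap (AdjoinRoot g₂) (AdjoinRoot g₄)) (root_sq_of_eq _ g₂ hg₂)
    rw [map_pow, ← AdjoinRoot.algebraMap_eq, ← IsScalarTower.algebraMap_apply, ← IsScalarTower.algebraMap_apply, map_mul] at h
    exact h
  have R3 : (AdjoinRoot.of g₄ (AdjoinRoot.root g₃)) ^ 2 = xT * aM (X 3) := by
    have h := root_sq_of_eq _ g₃ hg₃
    rw [← AdjoinRoot.algebraMap_eq g₃, ← IsScalarTower.algebraMap_apply] at h
    have h' := congrArg (AdjoinRoot.of g₄) h
    have eB : AdjoinRoot.of g₄ (algebraMap (MvPolynomial (Fin 4) k) (AdjoinRoot g₃) (X 0 * X 3)) = aM (X 0 * X 3) := by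
      rw [IsScalarTower.algebraMap_apply (MvPolynomial (Fin 4) k) (AdjoinRoot g₃) (AdjoinRoot g₄), AdjoinRoot.algebraMap_eq g₄]
    rw [map_pow, eB, map_mul] at h'
    exact h'
  -- `ψ ∘ φ = ιT`
  have hcomp : ψ.comp φ = ιT := by
    refine tower_ringHom_ext k g₁ g₂ g₃ g₄ (fun a => ?_) (fun i => ?_) ?_ ?_ ?_ ?_
    · rw [RingHom.comp_apply, hφC, hψι, hψC]
    · rw [RingHom.comp_apply, hφX]
      fin_cases i
      · change ψ (ι (mkA (X 0))) = ιT (aM (X 0))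
        rw [hψι, hψx]
      · change ψ (ι (mkA (X 1)) ^ 2 * inv) = ιT (aM (X 1))
        rw [map_mul, map_pow, hψι, hψX 1]
        change ιT (algebraMap (AdjoinRoot g₁) (AdjoinRoot g₄) (AdjoinRoot.root g₁)) ^ 2 * ψ inv = ιT (aM (X 1))
        rw [← map_pow ιT, R1]
        exact hcan (aM (X 1))
      · change ψ (ι (mkA (X 2)) ^ 2 * inv) = ιT (aM (X 2))
        rw [map_mul, map_pow, hψι, hψX 2]
        change ιT (algebraMap (AdjoinRoot g₂) (AdjoinRoot g₄) (AdjoinRoot.root g₂)) ^ 2 * ψ inv = ιT (aM (X 2))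
        rw [← map_pow ιT, R2]
        exact hcan (aM (X 2))
      · change ψ (ι (mkA (X 3)) ^ 2 * inv) = ιT (aM (X 3))
        rw [map_mul, map_pow, hψι, hψX 3]
        change ιT (AdjoinRoot.of g₄ (AdjoinRoot.root g₃)) ^ 2 * ψ inv = ιT (aM (X 3))
        rw [← map_pow ιT, R3]
        exact hcan (aM (X 3))
    · rw [RingHom.comp_apply, hφy, hψι, hψX 1]; rfl
    · rw [RingHom.comp_apply, hφu, hψι, hψX 2]; rfl
    · rw [RingHom.comp_apply, hφt, hψι, hψX 3]; rfl
    · rw [RingHom.comp_apply, hφW, map_mul, hψι, hψX 4]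
      exact hcan (AdjoinRoot.root g₄)
  have h2 : Function.Injective (⇑ψ ∘ ⇑φ) := by rw [← RingHom.coe_comp, hcomp]; exact hιT_inj
  exact h2.of_comp

/-! ## §2 ★★ `T₄ ≃ A₀[τ/x̄]` -/

set_option synthInstance.maxHeartbeats 200000 in
set_option maxHeartbeats 1600000 in
-- generator bookkeeping on both sides
/-- ★★ **The tower `T₄` is the Rees chart `D(x̄)` of `Bl_τ X`**: `e : T₄ ≃+* blowupAlgebra τ x̄` with
`x, W₀, W₁, W₂, y, u, t, W₄ ↦ x̄, ȳ²/x̄, ū²/x̄, t̄²/x̄, ȳ, ū, t̄, z̄/x̄` (values in `A₀[1/x̄]`). [cite: GortzWedhorn2020, (13.19) p. 415] -/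
theorem exists_chartEquiv (f : MvPolynomial (Fin 5) k) (hf : f = X 4 ^ 2 + X 0 ^ 2 * X 4 + X 1 ^ 5 + X 2 ^ 5 + X 3 ^ 5)
    (g₁ : Polynomial (MvPolynomial (Fin 4) k)) (hg₁ : g₁ = Polynomial.X ^ 2 - Polynomial.C (X 0 * X 1))
    (g₂ : Polynomial (AdjoinRoot g₁)) (hg₂ : g₂ = Polynomial.X ^ 2 - Polynomial.C (algebraMap (MvPolynomial (Fin 4) k) (AdjoinRoot g₁) (X 0 * X 2)))
    (g₃ : Polynomial (AdjoinRoot g₂)) (hg₃ : g₃ = Polynomial.X ^ 2 - Polynomial.C (algebraMap (MvPolynomial (Fin 4) k) (AdjoinRoot g₂) (X 0 * X 3)))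
    (g₄ : Polynomial (AdjoinRoot g₃))
    (hg₄ : g₄ = Polynomial.X ^ 2 + (Polynomial.C (algebraMap (MvPolynomial (Fin 4) k) (AdjoinRoot g₃) (X 0)) * Polynomial.X +
      Polynomial.C (algebraMap (MvPolynomial (Fin 4) k) (AdjoinRoot g₃) (X 1 ^ 2) * algebraMap (AdjoinRoot g₁) (AdjoinRoot g₃) (AdjoinRoot.root g₁) +
        algebraMap (MvPolynomial (Fin 4) k) (AdjoinRoot g₃) (X 2 ^ 2) * AdjoinRoot.of g₃ (AdjoinRoot.root g₂) +
        algebraMap (MvPolynomial (Fin 4) k) (AdjoinRoot g₃) (X 3 ^ 2) * AdjoinRoot.root g₃))) :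
    ∃ e : AdjoinRoot g₄ ≃+* blowupAlgebra (Ideal.span {Ideal.Quotient.mk (Ideal.span {f}) (X 0), Ideal.Quotient.mk (Ideal.span {f}) (X 1) ^ 2,
          Ideal.Quotient.mk (Ideal.span {f}) (X 2) ^ 2, Ideal.Quotient.mk (Ideal.span {f}) (X 3) ^ 2, Ideal.Quotient.mk (Ideal.span {f}) (X 4)} :
            Ideal (MvPolynomial (Fin 5) k ⧸ Ideal.span {f})) (Ideal.Quotient.mk (Ideal.span {f}) (X 0)),
      (∀ a : k, ((e (algebraMap (MvPolynomial (Fin 4) k) (AdjoinRoot g₄) (C a)) : blowupAlgebra _ (Ideal.Quotient.mk (Ideal.span {f}) (X 0))) : Localization.Away (Ideal.Quotient.mk (Ideal.span {f}) (X 0) : MvPolynomial (Fin 5) k ⧸ Ideal.span {f})) =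
        algebraMap (MvPolynomial (Fin 5) k ⧸ Ideal.span {f}) (Localization.Away (Ideal.Quotient.mk (Ideal.span {f}) (X 0) : MvPolynomial (Fin 5) k ⧸ Ideal.span {f})) (Ideal.Quotient.mk (Ideal.span {f}) (C a))) ∧
      (∀ i : Fin 4, ((e (algebraMap (MvPolynomial (Fin 4) k) (AdjoinRoot g₄) (X i)) : blowupAlgebra _ (Ideal.Quotient.mk (Ideal.span {f}) (X 0))) : Localization.Away (Ideal.Quotient.mk (Ideal.span {f}) (X 0) : MvPolynomial (Fin 5) k ⧸ Ideal.span {f})) =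
        ![algebraMap (MvPolynomial (Fin 5) k ⧸ Ideal.span {f}) (Localization.Away (Ideal.Quotient.mk (Ideal.span {f}) (X 0) : MvPolynomial (Fin 5) k ⧸ Ideal.span {f})) (Ideal.Quotient.mk (Ideal.span {f}) (X 0)),
          algebraMap (MvPolynomial (Fin 5) k ⧸ Ideal.span {f}) (Localization.Away (Ideal.Quotient.mk (Ideal.span {f}) (X 0) : MvPolynomial (Fin 5) k ⧸ Ideal.span {f})) (Ideal.Quotient.mk (Ideal.span {f}) (X 1)) ^ 2 * Away.invSelf (Ideal.Quotient.mk (Ideal.span {f}) (X 0)),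
          algebraMap (MvPolynomial (Fin 5) k ⧸ Ideal.span {f}) (Localization.Away (Ideal.Quotient.mk (Ideal.span {f}) (X 0) : MvPolynomial (Fin 5) k ⧸ Ideal.span {f})) (Ideal.Quotient.mk (Ideal.span {f}) (X 2)) ^ 2 * Away.invSelf (Ideal.Quotient.mk (Ideal.span {f}) (X 0)),
          algebraMap (MvPolynomial (Fin 5) k ⧸ Ideal.span {f}) (Localization.Away (Ideal.Quotient.mk (Ideal.span {f}) (X 0) : MvPolynomial (Fin 5) k ⧸ Ideal.span {f})) (Ideal.Quotient.mk (Ideal.span {f}) (X 3)) ^ 2 * Away.invSelf (Ideal.Quotient.mk (Ideal.span {f}) (X 0))] i) ∧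
      ((e (algebraMap (AdjoinRoot g₁) (AdjoinRoot g₄) (AdjoinRoot.root g₁)) : blowupAlgebra _ (Ideal.Quotient.mk (Ideal.span {f}) (X 0))) : Localization.Away (Ideal.Quotient.mk (Ideal.span {f}) (X 0) : MvPolynomial (Fin 5) k ⧸ Ideal.span {f})) =
        algebraMap (MvPolynomial (Fin 5) k ⧸ Ideal.span {f}) (Localization.Away (Ideal.Quotient.mk (Ideal.span {f}) (X 0) : MvPolynomial (Fin 5) k ⧸ Ideal.span {f})) (Ideal.Quotient.mk (Ideal.span {f}) (X 1)) ∧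
      ((e (algebraMap (AdjoinRoot g₂) (AdjoinRoot g₄) (AdjoinRoot.root g₂)) : blowupAlgebra _ (Ideal.Quotient.mk (Ideal.span {f}) (X 0))) : Localization.Away (Ideal.Quotient.mk (Ideal.span {f}) (X 0) : MvPolynomial (Fin 5) k ⧸ Ideal.span {f})) =
        algebraMap (MvPolynomial (Fin 5) k ⧸ Ideal.span {f}) (Localization.Away (Ideal.Quotient.mk (Ideal.span {f}) (X 0) : MvPolynomial (Fin 5) k ⧸ Ideal.span {f})) (Ideal.Quotient.mk (Ideal.span {f}) (X 2)) ∧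
      ((e (AdjoinRoot.of g₄ (AdjoinRoot.root g₃)) : blowupAlgebra _ (Ideal.Quotient.mk (Ideal.span {f}) (X 0))) : Localization.Away (Ideal.Quotient.mk (Ideal.span {f}) (X 0) : MvPolynomial (Fin 5) k ⧸ Ideal.span {f})) =
        algebraMap (MvPolynomial (Fin 5) k ⧸ Ideal.span {f}) (Localization.Away (Ideal.Quotient.mk (Ideal.span {f}) (X 0) : MvPolynomial (Fin 5) k ⧸ Ideal.span {f})) (Ideal.Quotient.mk (Ideal.span {f}) (X 3)) ∧
      ((e (AdjoinRoot.root g₄) : blowupAlgebra _ (Ideal.Quotient.mk (Ideal.span {f}) (X 0))) : Localization.Away (Ideal.Quotient.mk (Ideal.span {f}) (X 0) : MvPolynomial (Fin 5) k ⧸ Ideal.span {f})) =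
        algebraMap (MvPolynomial (Fin 5) k ⧸ Ideal.span {f}) (Localization.Away (Ideal.Quotient.mk (Ideal.span {f}) (X 0) : MvPolynomial (Fin 5) k ⧸ Ideal.span {f})) (Ideal.Quotient.mk (Ideal.span {f}) (X 4)) * Away.invSelf (Ideal.Quotient.mk (Ideal.span {f}) (X 0)) := by
  classical
  obtain ⟨φ, hφC, hφX, hφy, hφu, hφt, hφW⟩ := exists_chartMap k f hf g₁ hg₁ g₂ hg₂ g₃ hg₃ g₄ hg₄
  have hinj := chartMap_injective k f hf g₁ hg₁ g₂ hg₂ g₃ hg₃ g₄ hg₄ φ hφC hφX hφy hφu hφt hφW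
  obtain ⟨ψ₁, hψX, hψC⟩ := exists_blowdownMap k f hf g₁ hg₁ g₂ hg₂ g₃ hg₃ g₄ hg₄
  let mkA : MvPolynomial (Fin 5) k →+* MvPolynomial (Fin 5) k ⧸ Ideal.span {f} := Ideal.Quotient.mk (Ideal.span {f})
  let τ : Ideal (MvPolynomial (Fin 5) k ⧸ Ideal.span {f}) := Ideal.span {mkA (X 0), mkA (X 1) ^ 2, mkA (X 2) ^ 2, mkA (X 3) ^ 2, mkA (X 4)}
  let L := Localization.Away (mkA (X 0))
  let B : Subalgebra (MvPolynomial (Fin 5) k ⧸ Ideal.span {f}) L := blowupAlgebra τ (mkA (X 0))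
  let ι : (MvPolynomial (Fin 5) k ⧸ Ideal.span {f}) →+* L := algebraMap _ _
  let inv : L := Away.invSelf (mkA (X 0))
  let aM : MvPolynomial (Fin 4) k →+* AdjoinRoot g₄ := algebraMap _ _
  have hxi : ι (mkA (X 0)) * inv = 1 := Away.mul_invSelf (S := L) (mkA (X 0))
  -- (1) `φ ∘ ψ₁ = ι`
  have hφψ : φ.comp ψ₁ = ι := by
    refine Ideal.Quotient.ringHom_ext (MvPolynomial.ringHom_ext (fun a => ?_) (fun j => ?_))
    · change φ (ψ₁ (mkA (C a))) = ι (mkA (C a))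
      rw [hψC, hφC]
    · change φ (ψ₁ (mkA (X j))) = ι (mkA (X j))
      rw [hψX]
      fin_cases j
      · exact hφX 0
      · exact hφy
      · exact hφu
      · exact hφt
      · change φ (aM (X 0) * AdjoinRoot.root g₄) = ι (mkA (X 4))
        rw [map_mul, hφX 0, hφW]
        change ι (mkA (X 0)) * (ι (mkA (X 4)) * inv) = ι (mkA (X 4))
        rw [mul_comm, mul_assoc, mul_comm inv, hxi, mul_one]
  have hι_mem : ∀ a, ι a ∈ φ.range := fun a => ⟨ψ₁ a, by rw [← RingHom.comp_apply, hφψ]⟩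
  -- (2) `range φ ⊆ B`
  have hB₀ : ∀ b : MvPolynomial (Fin 4) k, φ (aM b) ∈ B := by
    intro b
    induction b using MvPolynomial.induction_on with
    | C a => rw [hφC]; exact B.algebraMap_mem _
    | add p q hp hq => rw [map_add, map_add]; exact B.add_mem hp hq
    | mul_X p i hp =>
      rw [map_mul, map_mul]
      refine B.mul_mem hp ?_
      rw [hφX]
      fin_cases i
      · exact B.algebraMap_mem (mkA (X 0))
      · change ι (mkA (X 1)) ^ 2 * inv ∈ B
        rw [← map_pow ι]
        exact div_mem_blowupAlgebra τ (mkA (X 0)) (Ideal.subset_span (by simp))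
      · change ι (mkA (X 2)) ^ 2 * inv ∈ B
        rw [← map_pow ι]
        exact div_mem_blowupAlgebra τ (mkA (X 0)) (Ideal.subset_span (by simp))
      · change ι (mkA (X 3)) ^ 2 * inv ∈ B
        rw [← map_pow ι]
        exact div_mem_blowupAlgebra τ (mkA (X 0)) (Ideal.subset_span (by simp))
  have eB : ∀ b : MvPolynomial (Fin 4) k, AdjoinRoot.of g₄ (AdjoinRoot.of g₃ (AdjoinRoot.of g₂ (AdjoinRoot.of g₁ b))) = aM b := fun b => by
    rw [← AdjoinRoot.algebraMap_eq, ← AdjoinRoot.algebraMap_eq, ← AdjoinRoot.algebraMap_eq, ← AdjoinRoot.algebraMap_eq,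
      ← IsScalarTower.algebraMap_apply, ← IsScalarTower.algebraMap_apply, ← IsScalarTower.algebraMap_apply]
  have ey : AdjoinRoot.of g₄ (AdjoinRoot.of g₃ (AdjoinRoot.of g₂ (AdjoinRoot.root g₁))) = algebraMap (AdjoinRoot g₁) (AdjoinRoot g₄) (AdjoinRoot.root g₁) := by
    rw [← AdjoinRoot.algebraMap_eq, ← AdjoinRoot.algebraMap_eq, ← AdjoinRoot.algebraMap_eq, ← IsScalarTower.algebraMap_apply, ← IsScalarTower.algebraMap_apply]
  have eu : AdjoinRoot.of g₄ (AdjoinRoot.of g₃ (AdjoinRoot.root g₂)) = algebraMap (AdjoinRoot g₂) (AdjoinRoot g₄) (AdjoinRoot.root g₂) := by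
    rw [← AdjoinRoot.algebraMap_eq, ← AdjoinRoot.algebraMap_eq, ← IsScalarTower.algebraMap_apply]
  have hrange_le : ∀ c, φ c ∈ B := by
    have l1 : ∀ x : AdjoinRoot g₁, (((φ.comp (AdjoinRoot.of g₄)).comp (AdjoinRoot.of g₃)).comp (AdjoinRoot.of g₂)) x ∈ B := by
      refine adjoinRoot_subring_eq_top g₁ (B.toSubring.comap (((φ.comp (AdjoinRoot.of g₄)).comp (AdjoinRoot.of g₃)).comp (AdjoinRoot.of g₂))) (fun b => ?_) ?_
      · change φ (AdjoinRoot.of g₄ (AdjoinRoot.of g₃ (AdjoinRoot.of g₂ (AdjoinRoot.of g₁ b)))) ∈ B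
        rw [eB]; exact hB₀ b
      · change φ (AdjoinRoot.of g₄ (AdjoinRoot.of g₃ (AdjoinRoot.of g₂ (AdjoinRoot.root g₁)))) ∈ B
        rw [ey, hφy]; exact B.algebraMap_mem _
    have l2 : ∀ x : AdjoinRoot g₂, ((φ.comp (AdjoinRoot.of g₄)).comp (AdjoinRoot.of g₃)) x ∈ B := by
      refine adjoinRoot_subring_eq_top g₂ (B.toSubring.comap ((φ.comp (AdjoinRoot.of g₄)).comp (AdjoinRoot.of g₃))) (fun b => l1 b) ?_
      change φ (AdjoinRoot.of g₄ (AdjoinRoot.of g₃ (AdjoinRoot.root g₂))) ∈ B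
      rw [eu, hφu]; exact B.algebraMap_mem _
    have l3 : ∀ x : AdjoinRoot g₃, (φ.comp (AdjoinRoot.of g₄)) x ∈ B := by
      refine adjoinRoot_subring_eq_top g₃ (B.toSubring.comap (φ.comp (AdjoinRoot.of g₄))) (fun b => l2 b) ?_
      change φ (AdjoinRoot.of g₄ (AdjoinRoot.root g₃)) ∈ B
      rw [hφt]; exact B.algebraMap_mem _
    refine adjoinRoot_subring_eq_top g₄ (B.toSubring.comap φ) (fun b => l3 b) ?_
    change φ (AdjoinRoot.root g₄) ∈ B
    rw [hφW]
    change ι (mkA (X 4)) * inv ∈ B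
    exact div_mem_blowupAlgebra τ (mkA (X 0)) (Ideal.subset_span (by simp))
  -- (3) `B ⊆ range φ`
  let Rφ : Subalgebra (MvPolynomial (Fin 5) k ⧸ Ideal.span {f}) L :=
    { carrier := φ.range
      mul_mem' := fun ha hb => φ.range.mul_mem ha hb
      one_mem' := φ.range.one_mem
      add_mem' := fun ha hb => φ.range.add_mem ha hb
      zero_mem' := φ.range.zero_mem
      algebraMap_mem' := fun a => hι_mem a }
  have hgens : blowupAlgebraGens τ (mkA (X 0)) ⊆ (Rφ : Set L) := by
    rintro _ ⟨g, hg, rfl⟩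
    change ι g * inv ∈ φ.range
    refine Submodule.span_induction (p := fun g _ => ι g * inv ∈ φ.range) ?_ ?_ ?_ ?_ hg
    · intro g hg
      simp only [Set.mem_insert_iff, Set.mem_singleton_iff] at hg
      rcases hg with rfl | rfl | rfl | rfl | rfl
      · exact ⟨1, by rw [map_one, hxi]⟩
      · exact ⟨aM (X 1), by rw [hφX 1, map_pow ι]; rfl⟩
      · exact ⟨aM (X 2), by rw [hφX 2, map_pow ι]; rfl⟩
      · exact ⟨aM (X 3), by rw [hφX 3, map_pow ι]; rfl⟩
      · exact ⟨AdjoinRoot.root g₄, hφW⟩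
    · rw [map_zero, zero_mul]; exact φ.range.zero_mem
    · intro a b _ _ ha hb
      rw [map_add, add_mul]; exact φ.range.add_mem ha hb
    · intro r a _ ha
      rw [smul_eq_mul, map_mul, mul_assoc]; exact φ.range.mul_mem (hι_mem r) ha
  have hle_range : B ≤ Rφ := Algebra.adjoin_le hgens
  have hsurj : Function.Surjective (φ.codRestrict B.toSubring fun c => hrange_le c) := by
    intro b
    obtain ⟨c, hc⟩ := (hle_range b.2 : (b : L) ∈ φ.range)
    exact ⟨c, Subtype.ext hc⟩
  have hinj' : Function.Injective (φ.codRestrict B.toSubring fun c => hrange_le c) := fun a b h => hinj (congrArg Subtype.val h)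
  exact ⟨RingEquiv.ofBijective (φ.codRestrict B.toSubring fun c => hrange_le c) ⟨hinj', hsurj⟩, hφC, hφX, hφy, hφu, hφt, hφW⟩

/-! ## §3 CM at every prime of `A₀[τ/x̄]` -/

set_option synthInstance.maxHeartbeats 200000 in
set_option maxHeartbeats 1600000 in
-- instance assembly along the tower + one transport
/-- ★★ **CM at every prime of `A₀[τ/x̄]`** — by the generic flat–integral engine (p629082) applied to the free finite tower `T₄ / k[x,W₀,W₁,W₂]`, transported along
`T₄ ≃+* blowupAlgebra τ x̄`. [cite: Matsumura1987, Thm. 17.8, Thm. 23.3 (context)] -/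
theorem cmCl_localization_blowupAlgebra (f : MvPolynomial (Fin 5) k) (hf : f = X 4 ^ 2 + X 0 ^ 2 * X 4 + X 1 ^ 5 + X 2 ^ 5 + X 3 ^ 5)
    (Q : Ideal (blowupAlgebra (Ideal.span {Ideal.Quotient.mk (Ideal.span {f}) (X 0), Ideal.Quotient.mk (Ideal.span {f}) (X 1) ^ 2,
          Ideal.Quotient.mk (Ideal.span {f}) (X 2) ^ 2, Ideal.Quotient.mk (Ideal.span {f}) (X 3) ^ 2, Ideal.Quotient.mk (Ideal.span {f}) (X 4)} :
            Ideal (MvPolynomial (Fin 5) k ⧸ Ideal.span {f})) (Ideal.Quotient.mk (Ideal.span {f}) (X 0)))) [Q.IsPrime] :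
    CMCl (Localization.AtPrime Q) := by
  let g₁ : Polynomial (MvPolynomial (Fin 4) k) := Polynomial.X ^ 2 - Polynomial.C (X 0 * X 1)
  let g₂ : Polynomial (AdjoinRoot g₁) := Polynomial.X ^ 2 - Polynomial.C (algebraMap (MvPolynomial (Fin 4) k) (AdjoinRoot g₁) (X 0 * X 2))
  let g₃ : Polynomial (AdjoinRoot g₂) := Polynomial.X ^ 2 - Polynomial.C (algebraMap (MvPolynomial (Fin 4) k) (AdjoinRoot g₂) (X 0 * X 3))
  let g₄ : Polynomial (AdjoinRoot g₃) := Polynomial.X ^ 2 + (Polynomial.C (algebraMap (MvPolynomial (Fin 4) k) (AdjoinRoot g₃) (X 0)) * Polynomial.X +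
      Polynomial.C (algebraMap (MvPolynomial (Fin 4) k) (AdjoinRoot g₃) (X 1 ^ 2) * algebraMap (AdjoinRoot g₁) (AdjoinRoot g₃) (AdjoinRoot.root g₁) +
        algebraMap (MvPolynomial (Fin 4) k) (AdjoinRoot g₃) (X 2 ^ 2) * AdjoinRoot.of g₃ (AdjoinRoot.root g₂) +
        algebraMap (MvPolynomial (Fin 4) k) (AdjoinRoot g₃) (X 3 ^ 2) * AdjoinRoot.root g₃))
  obtain ⟨hfree, hfin⟩ := free_finite_tower k g₁ rfl g₂ rfl g₃ rfl g₄ rfl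
  haveI : Algebra.IsIntegral (MvPolynomial (Fin 4) k) (AdjoinRoot g₄) := Algebra.IsIntegral.of_finite _ _
  obtain ⟨e, -⟩ := exists_chartEquiv k f hf g₁ rfl g₂ rfl g₃ rfl g₄ rfl
  exact ReesChartFacts.transport_cmCl e (fun P _ => FlatIntegralCM.cmCl_localization_of_isRegularRing (A := MvPolynomial (Fin 4) k) P) Q

end Summit.ResolutionOfSingularities.ResolutionOfSingularities.Theorems.FInjectiveMacaulayfication.TauFloorF5XChartIdent

end
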